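import Summits.NavierStokesRegularity.NavierStokesRegularity.Theses.AdaptedFrequency
import Summits.NavierStokesRegularity.NavierStokesRegularity.Theorems.AdaptedFrequencyFrequencyRigidityFiniteABGlueRoute
import Summits.NavierStokesRegularity.NavierStokesRegularity.Theorems.AdaptedFrequencyTangentFlowTransferFiniteAB
import Summits.NavierStokesRegularity.NavierStokesRegularity.Theorems.AdaptedFrequencyFrequencyRigidityOfTypeIAncientLiouville
import Summits.NavierStokesRegularity.NavierStokesRegularity.Theorems.AdaptedFrequencyFrequencyRigidityWallUnconditional
import Summits.NavierStokesRegularity.NavierStokesRegularity.Theorems.AdaptedFrequencyFrequencyRigidityFiniteABGlue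

/-!
# Lead c10 verdict check — crux `FrequencyRigidity` (stmt-NavierStokesRegularity-2955), 2026-08-17

Every arrow the c10 verdict rests on, BY NAME, against the current tree (this file must elaborate rc 0,
0 sorries; `#print axioms` of each must be ⊆ {propext, Classical.choice, Quot.sound}):

(1) the route's deciding theorem closes from the FINITE CHILD (Stub 2′, Albritton–Barker form) alone:
    `finiteAB_navierStokesRegularity_of_finiteChild : AdaptedFrequencyConverges → Stub 2′ → NoTypeII → NavierStokesRegularity`;
(2) every tangent flow the route hands to the crux lies in the A–B class: `tangentFlowTransfer_finiteAB`
    (= the hypotheses of item TangentFlowTransfer ⇒ its conclusion ∧ the A–B clause);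
(3) the crux AS FILED implies bounded non-decaying rotated-self-similar Liouville for EVERY α
    (`rssWall_unconditional`; α ≠ 0 = Bradshaw–Tsai OP 5.2 ⊋ Pineau–Vicol 2026 Conj. 1.1, open);
(4) the crux AS FILED follows from item stmt-4050 `TypeIAncientLiouville` (`frequencyRigidity_of_typeIAncientLiouville`);
(5) the crux AS FILED implies Stub 2′ (`finiteAB_stub2AB_of_frequencyRigidity`): the proposed restatement is WEAKER.
-/

namespace VerdictCheckC10
open Summit.NavierStokesRegularity.NavierStokesRegularity

/-- (1) R1: the route closes from Stub 2′. -/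
example := @Theorems.finiteAB_navierStokesRegularity_of_finiteChild
/-- (2) the enabler: tangent flows are in the A–B class. -/
example := @Theorems.tangentFlowTransfer_finiteAB
/-- (3) the filed crux carries BT OP 5.2. -/
example : Theses.AdaptedFrequency.FrequencyRigidity →
    ∀ α : ℝ, Theorems.FrequencyRigidity.Negative.RSSLiouvilleBounded α :=
  Theorems.FrequencyRigidity.MovingAdjointBernoulli.rssWall_unconditional
/-- (4) the filed crux ⇐ stmt-4050. -/
example : Theses.ExtremalTypeIConstant.TypeIAncientLiouville → Theses.AdaptedFrequency.FrequencyRigidity :=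
  Theorems.FrequencyRigidity.TwoEndedPinning.frequencyRigidity_of_typeIAncientLiouville
/-- (5) filed crux ⇒ Stub 2′. -/
example := @Theorems.finiteAB_stub2AB_of_frequencyRigidity

#print axioms Summit.NavierStokesRegularity.NavierStokesRegularity.Theorems.finiteAB_navierStokesRegularity_of_finiteChild
#print axioms Summit.NavierStokesRegularity.NavierStokesRegularity.Theorems.tangentFlowTransfer_finiteAB
#print axioms Summit.NavierStokesRegularity.NavierStokesRegularity.Theorems.FrequencyRigidity.MovingAdjointBernoulli.rssWall_unconditional
#print axioms Summit.NavierStokesRegularity.NavierStokesRegularity.Theorems.FrequencyRigidity.TwoEndedPinning.frequencyRigidity_of_typeIAncientLiouville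
#print axioms Summit.NavierStokesRegularity.NavierStokesRegularity.Theorems.finiteAB_stub2AB_of_frequencyRigidity

end VerdictCheckC10
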